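import Summits.QuantumFields.BalabanUV.T4Continuum.Support.ShellMeasureLandauPinnedBudget

/-!
# `T4Continuum.ShellMeasureLandauPinnedBudgetDesigned` — THE REPAIRED w-CHAIN BUDGET IS INHABITED BY DESIGNED-SIZE LETTERS AT THE
# TREE's d = 4 CONSTANTS (the positive twin of `ShellMeasureLandauPinnedBudget.not_hk_of_designed`; a number-row G-1 instance
# for the v6 hosts of row S112)
(cell `pub-balaban`, sub-cell `t4`, spine estimate NE7c (node U5b); NE7c ROUND-2 crew, unit `b2b-balaban-t4-ne7c-formalise-leaf-04`
gen 12 — the S108 lineage; own-initiative LEMMA file of an idle seat answering the «NEVER EXERCISED» sentence of FINDING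
F-ne7cleaf06g9-1 (leaf-06-g9; owner R-ne7cp1-g36-14 (a)) and this lineage's XREAD INFO-2 on p239711 (journal `CLAIMS.log` l.22862:
S108 f1 §4 `numberRows_inhabited` and every «parametric in the tree constants» G-1 instance of the END hosts OMIT `hk` or take zero
w-kernels); ADDITIVE — imports `ShellMeasureLandauPinnedBudget` (leaf-06-g9, p239711: `numbers_d4`, hence `C2cov`, `landauRad`) ONLY;
touches NO host; [folklore]; 0 `def`, 0 `def … : Prop`, 0 sorry, 0 citation tags)

HONEST FRAMING.  Arithmetic on OUR displayed letters; nothing about Bałaban's minimiser, propagators or kernels is computed, asserted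
or discharged.  Finite four-torus programme, rung (B)+1 only — NOT infinite volume, NOT a mass gap, NOT the Clay problem, NOT summit
progress; NE7c (`T4IndicatorShell.ShellWeightBound`) NOT PRINTED, NOT PROVED; «NE7c ⇐ the named binders» (c3).  HONEST DEPENDENCY (cell):
continuum YM on T⁴ ⇐ BetaPertH ∧ nine spine estimates (0/9 proved); BetaPertH ⇐ (D1) ∧ (D4) ∧ CAP+tail; G-an2-4 gates asym, D1 and
NE2/3/4.

THE POINT.  After row S112 (leaf-07-g10: `ShellMeasureLandauPinnedFieldRadius` p239701, `…WilsonSquaresKernelsSchwarzField` p239911,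
the v6 root and chain per R-ne7cp1-g37-1) the (T2) pinned w-chain of every END host displays its number rows in print's FIELD-SIZE
shape: with `X := ε₄w + B₀w·bw`, the two contraction budgets are `hqW♯ : c𝒢M𝒢·(4·C₄w·X·e^{δw rW}) < 1` and
`hk♯ : 12·C₂·X·e^{δw rC}·(cιMι)·(cHMH) < 1` ([Balaban1985Variational] (120)–(121) p. 295 ∕ (53)–(54) p. 286 SHAPES — LOCATORS), with
`C₂ ↦ C2cov d` and `hRCw : 6X ≤ landauRad d L` downstream (S99 f3b′).  THIS FILE instantiates ALL FIFTEEN real-number rows of that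
chain AT THE TREE's four-dimensional constants (`C2cov 4 = 39 321 600`, `landauRad 4 L = 1∕78 643 200` for `L ≤ 61 440`) with
EVERY Schur product EQUAL TO ONE (`c𝒢M𝒢 = cιMι = cHMH = cH₁MH₁ = 1`: the designed restriction letter and unit-entry kernels at
distance 0 — exactly the sizes under which the OLD row is refuted), a LIVE (P4) constant `C₄w = 1`, the designed chart-map norm `‖Tw‖ = 6`
(S104's `(6∕(ηB₀))•id` at `η = B₀ = 1`), pin factors `e^{δw·r} = 1` (`δw·r = 0`), and the field size `X = 2⁻³⁰`:
`B₀w = 1`, `ε₄w = bw = 2⁻³¹`, `a₃w = 2⁻²⁹`, `rΦw = 2⁻³⁴`, `S = 2⁻³⁵` — then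
`hB𝒢w hBH₁w hBHw` (`1 ≤ 1`), `hB₀w`, `hC₄w`, `hε₄w`, `hdomw` (`2X ≤ a₃w`), `hselfw` (`X² ≤ ε₄w`), `hcontrw` (`4X < 1`),
`hqw` (`9·C2cov 4·X = 0.3296 < 1`), `hRCw` (`6X = 5.59·10⁻⁹ ≤ 1.27·10⁻⁸`), `hqW♯` (`4X < 1`), **`hk♯` (`12·C2cov 4·X = 0.4395 < 1`)**,
`hTbw` (`6·2⁻³⁴ < 2⁻³¹`), `h2Sw` (`2·2⁻³⁵ ≤ 2⁻³⁴`) hold TOGETHER — while at the SAME values the v2–v5 row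
`hk : 2·C2cov 4·landauRad 4 L·e⁰·(1·1)·(1·1) < 1` is FALSE (`= 1`, `ShellMeasureLandauPinnedBudget.not_hk_of_designed`).  So the repair
is not only print-shaped but INHABITED by designed-size letters at the tree's own constants, and the v6 hosts' G-1 paragraphs may cite
`designedNumberRows_d4` BY NAME instead of zero-kernel instances.  WHAT THIS FILE DOES NOT DO: build kernels, fire a host, choose
Bałaban's constants (`B₀ ≥ 1` for `H` remains a READING), move any census count.  NOTHING in the countdown moves.
-/

noncomputable section

namespace Summit.QuantumFields.BalabanUV.T4Continuum.ShellMeasureLandauPinnedBudgetDesigned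

open Literature.MathematicalPhysics.QuantumFieldTheory.Balaban1983to89
open ShellMeasureAverageProp4General (C2cov)
open ShellMeasureLandauCorrectionB7 (landauRad)
open ShellMeasureLandauPinnedBudget (numbers_d4 not_hk_of_designed)

/-- **THE FIFTEEN NUMBER ROWS OF THE (T2) PINNED w-CHAIN IN THE v6 (FIELD-SIZE) SHAPE, AT THE TREE's d = 4 CONSTANTS, WITH UNIT
SCHUR PRODUCTS AND A LIVE (P4) CONSTANT** — in the hosts' letter order: `hB𝒢w hBH₁w hBHw` (`c·M· ≤ B₀w` with `c·M· = 1`), `hB₀w`,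
`hC₄w`, `hε₄w`, `hdomw`, `hselfw`, `hcontrw`, `hqw` (`9·C2cov 4·B₀w·X < 1`), `hRCw` (`6X ≤ landauRad 4 L`),
`hqW♯` (`c𝒢M𝒢·(4·C₄w·X·e^{δw rW}) < 1`), `hk♯` (`12·C2cov 4·X·e^{δw rC}·(cιMι)·(cHMH) < 1`), `hTbw` (`‖Tw‖·rΦw < bw` at `‖Tw‖ = 6`),
`h2Sw`, at `B₀w = C₄w = 1`, `ε₄w = bw = 2⁻³¹`, `a₃w = 2⁻²⁹`, `δw·r = 0`, `rΦw = 2⁻³⁴`, `S = 2⁻³⁵` (`1 ≤ L ≤ 61 440`). [folklore] -/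
theorem designedNumberRows_d4 {L : ℕ} (hL : 1 ≤ L) (hL' : (L : ℝ) ≤ 61440) :
    let B₀w : ℝ := 1
    let C₄w : ℝ := 1
    let ε₄w : ℝ := (2 ^ 31)⁻¹
    let bw : ℝ := (2 ^ 31)⁻¹
    let a₃w : ℝ := (2 ^ 29)⁻¹
    let rΦw : ℝ := (2 ^ 34)⁻¹
    let S : ℝ := (2 ^ 35)⁻¹
    (1 : ℝ) * 1 ≤ B₀w ∧ (1 : ℝ) * 1 ≤ B₀w ∧ (1 : ℝ) * 1 ≤ B₀w ∧ 0 < B₀w ∧ 0 ≤ C₄w ∧ 0 ≤ ε₄w ∧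
      2 * (ε₄w + B₀w * bw) ≤ a₃w ∧ B₀w * C₄w * (ε₄w + B₀w * bw) ^ 2 ≤ ε₄w ∧ 4 * B₀w * C₄w * (ε₄w + B₀w * bw) < 1 ∧
      9 * C2cov 4 * B₀w * (ε₄w + B₀w * bw) < 1 ∧ 6 * (ε₄w + B₀w * bw) ≤ landauRad 4 L ∧
      (1 : ℝ) * 1 * (4 * C₄w * (ε₄w + B₀w * bw) * Real.exp (0 * 0)) < 1 ∧
      12 * C2cov 4 * (ε₄w + B₀w * bw) * Real.exp (0 * 0) * ((1 : ℝ) * 1) * ((1 : ℝ) * 1) < 1 ∧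
      6 * rΦw < bw ∧ 2 * S ≤ rΦw ∧ 0 < S := by
  obtain ⟨_, hC2, hlr, _⟩ := numbers_d4 hL hL'
  simp only [mul_zero, Real.exp_zero, mul_one, one_mul]
  rw [hC2, hlr]
  norm_num

/-- … while AT THE SAME VALUES the v2–v5 row `hk : 2·C2cov 4·landauRad 4 L·e^{δw rC}·(cιMι)·(cHMH) < 1` FAILS (its factor is `= 1`;
`ShellMeasureLandauPinnedBudget.not_hk_of_designed` BY NAME). [folklore] -/
theorem old_hk_fails_d4 {L : ℕ} (hL : 1 ≤ L) (hL' : (L : ℝ) ≤ 61440) :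
    ¬ 2 * C2cov 4 * landauRad 4 L * Real.exp (0 * 0) * ((1 : ℝ) * 1) * ((1 : ℝ) * 1) < 1 :=
  not_hk_of_designed hL (hL'.trans (by norm_num)) (le_of_eq (zero_mul (0 : ℝ)).symm) (by norm_num) (by norm_num)

/-- the general-`d` form of the positive half, parametric in the Schur products and the (P4) constant but AT the tree's radius:
for ANY `P𝒢, Pι, PH, PH₁ ≥ 0` (Schur products), `C₄ ≥ 0`, pin factors `E_W, E_C ≥ 1` and any `d`, `1 ≤ L`, a field size `X > 0`
small enough makes `hqW♯`, `hk♯`, `hqw`, `hRCw`, `hcontrw` hold together with `B₀w := P𝒢 + Pι + PH + PH₁ + 1` — the field-size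
shape is inhabitable WHATEVER the letters' sizes (contrast: the old `hk` bounds the PRODUCT `E_C·Pι·PH` by `1∕(2·C2cov·landauRad) = 1`).
[folklore] -/
theorem fieldShape_inhabited (d : ℕ) {L : ℕ} (hL : 1 ≤ L) {P𝒢 Pι PH PH₁ C₄ EW EC : ℝ} (hP𝒢 : 0 ≤ P𝒢) (hPι : 0 ≤ Pι)
    (hPH : 0 ≤ PH) (hPH₁ : 0 ≤ PH₁) (hC₄ : 0 ≤ C₄) (hEW : 1 ≤ EW) (hEC : 1 ≤ EC) :
    ∃ B₀w X : ℝ, P𝒢 ≤ B₀w ∧ Pι ≤ B₀w ∧ PH ≤ B₀w ∧ PH₁ ≤ B₀w ∧ 0 < B₀w ∧ 0 < X ∧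
      4 * B₀w * C₄ * X < 1 ∧ 9 * C2cov d * B₀w * X < 1 ∧ 6 * X ≤ landauRad d L ∧
      P𝒢 * (4 * C₄ * X * EW) < 1 ∧ 12 * C2cov d * X * EC * Pι * PH < 1 := by
  have hC2 : 0 ≤ C2cov d := le_of_lt (by
    have := ShellMeasureAverageProp4General.C1cov_pos d
    unfold C2cov; positivity)
  have hlr : 0 < landauRad d L := ShellMeasureLandauCorrectionB7.landauRad_pos d hL
  set B : ℝ := P𝒢 + Pι + PH + PH₁ + 1 with hB
  have hB0 : 0 < B := by rw [hB]; linarith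
  -- one common denominator dominating every row's coefficient
  set K : ℝ := 4 * B * C₄ + 9 * C2cov d * B + 6 / landauRad d L + P𝒢 * (4 * C₄ * EW) + 12 * C2cov d * EC * Pι * PH + 1
    with hK
  have hK0 : 0 < K := by
    have h1 : 0 ≤ 4 * B * C₄ := by positivity
    have h2 : 0 ≤ 9 * C2cov d * B := by positivity
    have h3 : 0 ≤ 6 / landauRad d L := by positivity
    have h4 : 0 ≤ P𝒢 * (4 * C₄ * EW) := by
      have : 0 ≤ EW := by linarith
      positivity
    have h5 : 0 ≤ 12 * C2cov d * EC * Pι * PH := by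
      have : 0 ≤ EC := by linarith
      positivity
    rw [hK]; linarith
  refine ⟨B, 1 / (2 * K), by rw [hB]; linarith, by rw [hB]; linarith, by rw [hB]; linarith, by rw [hB]; linarith, hB0,
    by positivity, ?_, ?_, ?_, ?_, ?_⟩
  · -- `4·B·C₄·X < 1`
    have h : 4 * B * C₄ ≤ K := by
      rw [hK]
      have : 0 ≤ 9 * C2cov d * B := by positivity
      have : 0 ≤ 6 / landauRad d L := by positivity
      have : 0 ≤ P𝒢 * (4 * C₄ * EW) := by have : 0 ≤ EW := by linarith
                                          positivity
      have : 0 ≤ 12 * C2cov d * EC * Pι * PH := by have : 0 ≤ EC := by linarith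
                                                   positivity
      linarith
    calc 4 * B * C₄ * (1 / (2 * K)) ≤ K * (1 / (2 * K)) := by
          exact mul_le_mul_of_nonneg_right h (by positivity)
      _ = 1 / 2 := by field_simp
      _ < 1 := by norm_num
  · have h : 9 * C2cov d * B ≤ K := by
      rw [hK]
      have : 0 ≤ 4 * B * C₄ := by positivity
      have : 0 ≤ 6 / landauRad d L := by positivity
      have : 0 ≤ P𝒢 * (4 * C₄ * EW) := by have : 0 ≤ EW := by linarith
                                          positivity
      have : 0 ≤ 12 * C2cov d * EC * Pι * PH := by have : 0 ≤ EC := by linarith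
                                                   positivity
      linarith
    calc 9 * C2cov d * B * (1 / (2 * K)) ≤ K * (1 / (2 * K)) := by
          exact mul_le_mul_of_nonneg_right h (by positivity)
      _ = 1 / 2 := by field_simp
      _ < 1 := by norm_num
  · -- `6X ≤ landauRad`
    have h : 6 / landauRad d L ≤ K := by
      rw [hK]
      have : 0 ≤ 4 * B * C₄ := by positivity
      have : 0 ≤ 9 * C2cov d * B := by positivity
      have : 0 ≤ P𝒢 * (4 * C₄ * EW) := by have : 0 ≤ EW := by linarith
                                          positivity
      have : 0 ≤ 12 * C2cov d * EC * Pι * PH := by have : 0 ≤ EC := by linarith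
                                                   positivity
      linarith
    have h' : 6 / landauRad d L * (1 / (2 * K)) ≤ 1 / 2 := by
      calc 6 / landauRad d L * (1 / (2 * K)) ≤ K * (1 / (2 * K)) := by
            exact mul_le_mul_of_nonneg_right h (by positivity)
        _ = 1 / 2 := by field_simp
    rw [div_mul_eq_mul_div, div_le_iff₀ hlr] at h'
    have : 6 * (1 / (2 * K)) = 6 / landauRad d L * (1 / (2 * K)) * landauRad d L := by
      field_simp
    linarith [mul_le_mul_of_nonneg_right h (by positivity : (0 : ℝ) ≤ 1 / (2 * K))]
  · have h : P𝒢 * (4 * C₄ * EW) ≤ K := by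
      rw [hK]
      have : 0 ≤ 4 * B * C₄ := by positivity
      have : 0 ≤ 9 * C2cov d * B := by positivity
      have : 0 ≤ 6 / landauRad d L := by positivity
      have : 0 ≤ 12 * C2cov d * EC * Pι * PH := by have : 0 ≤ EC := by linarith
                                                   positivity
      linarith
    calc P𝒢 * (4 * C₄ * (1 / (2 * K)) * EW) = P𝒢 * (4 * C₄ * EW) * (1 / (2 * K)) := by ring
      _ ≤ K * (1 / (2 * K)) := by exact mul_le_mul_of_nonneg_right h (by positivity)
      _ = 1 / 2 := by field_simp
      _ < 1 := by norm_num
  · have h : 12 * C2cov d * EC * Pι * PH ≤ K := by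
      rw [hK]
      have : 0 ≤ 4 * B * C₄ := by positivity
      have : 0 ≤ 9 * C2cov d * B := by positivity
      have : 0 ≤ 6 / landauRad d L := by positivity
      have : 0 ≤ P𝒢 * (4 * C₄ * EW) := by have : 0 ≤ EW := by linarith
                                          positivity
      linarith
    calc 12 * C2cov d * (1 / (2 * K)) * EC * Pι * PH = 12 * C2cov d * EC * Pι * PH * (1 / (2 * K)) := by ring
      _ ≤ K * (1 / (2 * K)) := by exact mul_le_mul_of_nonneg_right h (by positivity)
      _ = 1 / 2 := by field_simp
      _ < 1 := by norm_num

end Summit.QuantumFields.BalabanUV.T4Continuum.ShellMeasureLandauPinnedBudgetDesigned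

end
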